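import Summits.QuantumFields.BalabanUV.Beta.FP.TorusCompositeCovarianceOne
import Summits.QuantumFields.BalabanUV.Beta.FP.PeriodisedBorderIndexWard

/-!
# `BalabanUV.Beta.FP.TorusCompositeIndexWardOne` — road «FP» for binder row D1, ROUTE T, the OWNER d1-p3's SPEC-27 «THE (j, m) TORUS CALL FOR m ≥ 2»,
# presentation T-β GRADED: **(T-β-m) ORDER 1 AT EVERY DEPTH — THE COMPOSITE FIRST-ORDER INSERTION JET ALONG A TORUS PURE GAUGE IS THE COMMUTATOR OF THE
# COMPOSITE AVERAGING WITH THE DIAGONAL GAUGE GENERATORS (read at the ITERATED ROOTS on the coarse side), AND #19 ∕ #21's `q1` LETTER**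

WHAT.  With PART 1's chain-rule jet `compIns₁` (`FP/TorusCompositeCovarianceOne`): §1 linearity of the one-step jet `stepIns₁` and of `compIns₁` in the
direction; `stepIns₁_pureGauge_fun` (my g18 `PeriodisedBorderIndexWard.torus_Q11_pureGauge_fun` in `stepIns₁ ∕ Qstep ∕ rootPt` letters:
`stepIns₁ (Dλ) = c_ℓ • (R_λ · Qstep − Qstep · E_λ)`, `E_λ = diagonal (λ b.1)`, `R_λ = diagonal (λ (rootPt a.1))`).  §2 `compRows_mulVec_tgrad_fun` (the
composite averaging of a pure gauge is `σ_n ×` the top torus's pure gauge of `λ ∘ itRoot` — PART 1's `compRows_mul_tgrad` on a vector) and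
**`compIns₁_pureGauge_fun`**: `compIns₁ … n (Dλ) = diagonal (λ (itRoot n a.1)) · compRows … n − compRows … n · diagonal (λ b.1)` — by the SAME induction as
the covariance law: the chain rule's weight `θ_n` is exactly the one at which the top step's `E`-term cancels the lower commutator's `R`-term (no constants
survive).  §3 **`torus_q1_tower`** — #19 ∕ #21's `q1 : Xbar * 𝔔₀ + 𝔔₁ + 𝔔₀ * X = 𝔔′₁` BY TERM in the shape of my g21 `PeriodisedCompositeIndexWard.torus_q1_letter`:
`X := −(c • E_λ)` (#21's `hX` VERBATIM), `Xbar := c • diagonal (Σ_t tdelta M′ (pμ′ α + toSite (rs 0)) t · λ (itRoot (n+1) t))` (the coarse slot's root one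
level up, read through the iterated root), `𝔔₁ := Q₂₁(h) · compRows + Q₂₀ · (c • compIns₁ h)` with PART 2's `Q₂₁(w) := Σ_{a′} (c·θ_{n+1}·(compRows · w) a′) •
T^{a′}`, and `𝔔′₁ :=` the same word along `h + Dλ` (my g18 `torus_pureGauge_fun_of_presentation` one level up + §2).  [folklore] finite sums BY NAME; no
`def`, no `def … : Prop`, nothing cited, 0 sorry.  Nothing of the dictionary ∕ Bałaban's asserted; ORDER 2 (`q2` for the composite) needs `compIns₂` (the
second chain rule) and is NOT here.

HONEST DEPENDENCY (page 1, mandatory): continuum YM on T⁴ ⇐ BetaPertH ∧ nine spine estimates (0/9 proved); BetaPertH ⇐ (D1) ∧ (D4) ∧ CAP+tail;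
G-an2-4 gates asym, D1 and NE2/3/4.  HONEST FRAMING (cell contract, verbatim): «discharging `BetaPertH` makes Bałaban's UV stability UNCONDITIONAL —
a real constructive-QFT result; it is NOT the continuum limit and NOT the Clay problem.»  ABSOLUTE RULE (cell charter, verbatim): «No internally-minted
statement may enter as a cited fact. Every hypothesis is either kernel-proved in this package or a verbatim quotation of a PUBLISHED theorem with page
reference. The manuscript(s) under audit are NOT citable for their own disputed steps — they are the thing under adjudication; programme-internal
(2001/route/tribunal) claims are never citable.»  0 estimates; 0∕4 row-D1 binders; NOT (T-ID), NOT SDF, NOT D1, NOT BetaPertH, NOT continuum, NOT Clay.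
D1 formalisation swarm LEAF PROVER 02 (b2b-balaban-beta-d1-formalise-leaf-02 gen 22), 2026-08-22.  No existing file touched.
-/

noncomputable section

open scoped BigOperators

namespace Summit.QuantumFields.BalabanUV.Beta.FP.TorusCompositeIndexWardOne

open Matrix Finset
open Literature.MathematicalPhysics.QuantumFieldTheory
open Literature.MathematicalPhysics.QuantumFieldTheory.Balaban1983to89
open Literature.MathematicalPhysics.QuantumFieldTheory.Balaban1983to89.Beta
open B5Prop11Plancherel (fine)
open B6Lemma24Torus (pbox)
open AffineAveraging (Site box toSite unitVec)
open AveragingHessianKernelsRooted (vhSAt)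
open OneStepResolventKernel (Fib)
open Summit.QuantumFields.BalabanUV.Beta.BorderedHessian (bhKStepAt stepScale stepScale_ne_zero)
open Summit.QuantumFields.BalabanUV.Beta.FP.KernelPeriodisationFib (Idx perF)
open Summit.QuantumFields.BalabanUV.Beta.FP.KernelPeriodisationFibLoc (dper)
open Summit.QuantumFields.BalabanUV.Beta.FP.TorusGaugeCovariance (tdelta tgrad)
open Summit.QuantumFields.BalabanUV.Beta.FP.TorusGaugeCovariancePairing (wrapPt wrapPt_of_mem sum_tdelta_mul)
open Summit.QuantumFields.BalabanUV.Beta.FP.TorusGaugeCovarianceCoarse (coarsePt)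
open Summit.QuantumFields.BalabanUV.Beta.FP.PeriodisedBorderIndexWard (torus_Q11_pureGauge_fun torus_pureGauge_fun_of_presentation)
open Summit.QuantumFields.BalabanUV.Beta.FP.TorusCompositeObjects
open Summit.QuantumFields.BalabanUV.Beta.FP.TorusCompositeCovariance (rootPt rootPt_coe itRoot itRoot_zero itRoot_succ)
open Summit.QuantumFields.BalabanUV.Beta.FP.TorusCompositeCovarianceOne (stepIns₁ compIns₁ compIns₁_zero compRows_mul_tgrad prod_stepScale_mul_card_ne_zero')

variable {d : ℕ}

/-! ## §1 Linearity; the one-step jet along a pure gauge -/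

section OneStep

variable (M : Fin (d + 1) → ℕ) [∀ μ, NeZero (M μ)] (Lc : ℕ) [NeZero Lc] {r : Fin (d + 1) → ℕ}

omit [∀ μ, NeZero (M μ)] in
/-- [folklore] `stepIns₁` is additive in the direction. -/
theorem stepIns₁_add (r : Fin (d + 1) → ℕ) (w w' : ↥(pbox (fine Lc M)) × Fin (d + 1) → ℝ) :
    stepIns₁ M Lc r (w + w') = stepIns₁ M Lc r w + stepIns₁ M Lc r w' := by
  simp only [stepIns₁, Pi.add_apply, add_smul, Finset.sum_add_distrib]

omit [∀ μ, NeZero (M μ)] in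
/-- [folklore] `stepIns₁` is homogeneous in the direction. -/
theorem stepIns₁_smul (r : Fin (d + 1) → ℕ) (a : ℝ) (w : ↥(pbox (fine Lc M)) × Fin (d + 1) → ℝ) :
    stepIns₁ M Lc r (a • w) = a • stepIns₁ M Lc r w := by
  simp only [stepIns₁, Pi.smul_apply, smul_eq_mul, mul_smul, Finset.smul_sum]

/-- [folklore] **THE ONE-STEP JET ALONG A TORUS PURE GAUGE IS THE COMMUTATOR WITH THE DIAGONAL GAUGE GENERATORS** (my g18 `torus_Q11_pureGauge_fun`, in
`stepIns₁ ∕ Qstep ∕ rootPt` letters): `stepIns₁ (Dλ) = c_ℓ • (diagonal (λ (rootPt a.1)) · Qstep − Qstep · diagonal (λ b.1))`. -/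
theorem stepIns₁_pureGauge_fun (hr : r ∈ box (d + 1) Lc) (ℓ : ℕ) (lam : ↥(pbox (fine Lc M)) → ℝ) :
    stepIns₁ M Lc r (fun b : ↥(pbox (fine Lc M)) × Fin (d + 1) => ∑ s : ↥(pbox (fine Lc M)), tgrad (fine Lc M) (b.1, Sum.inl b.2) s * lam s)
      = ((Lc : ℝ) ^ (d + 1) * stepScale d Lc ℓ)⁻¹ •
          (Matrix.diagonal (fun a : ↥(pbox M) × Fin (d + 1) => lam (rootPt M Lc hr a.1)) * Qstep Lc M ℓ r
            - Qstep Lc M ℓ r * Matrix.diagonal (fun b : ↥(pbox (fine Lc M)) × Fin (d + 1) => lam b.1)) := by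
  have hR : (Matrix.diagonal fun a : ↥(pbox M) × Fin (d + 1) =>
        ∑ s : ↥(pbox (fine Lc M)), tdelta (fine Lc M) ((Lc : ℤ) • (a.1 : Site (d + 1)) + toSite r) s * lam s)
      = Matrix.diagonal fun a : ↥(pbox M) × Fin (d + 1) => lam (rootPt M Lc hr a.1) := by
    refine congrArg Matrix.diagonal (funext fun a => ?_)
    rw [← rootPt_coe M Lc hr a.1, sum_tdelta_mul, wrapPt_of_mem]
  rw [stepIns₁, torus_Q11_pureGauge_fun M hr ℓ lam (Q₁₀ := Qstep Lc M ℓ r) rfl, hR]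

end OneStep

/-! ## §2 The composite jet along a pure gauge -/

section Tower

variable (Lc : ℕ) [NeZero Lc]

/-- [folklore] additivity, THE INDUCTION STEP (push-inside types). -/
theorem compIns₁_add_step (n : ℕ) (M : Fin (d + 1) → ℕ) [∀ μ, NeZero (M μ)] (lev : ℕ → ℕ) (rs : ℕ → (Fin (d + 1) → ℕ))
    (h h' : ↥(pbox (towerTorus Lc (fine Lc M) n)) × Fin (d + 1) → ℝ)
    (ih : compIns₁ Lc (fine Lc M) (fun k => lev (k + 1)) (fun k => rs (k + 1)) n (h + h')
      = compIns₁ Lc (fine Lc M) (fun k => lev (k + 1)) (fun k => rs (k + 1)) n h + compIns₁ Lc (fine Lc M) (fun k => lev (k + 1)) (fun k => rs (k + 1)) n h') :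
    (((Lc : ℝ) ^ (d + 1) * stepScale d Lc (lev 1)) * (∏ i ∈ range n, (stepScale d Lc (lev (i + 1 + 1)) * ((box (d + 1) Lc).card : ℝ)))⁻¹) •
          (stepIns₁ M Lc (rs 1) (compRows Lc (fine Lc M) (fun k => lev (k + 1)) (fun k => rs (k + 1)) n *ᵥ (h + h'))
            * compRows Lc (fine Lc M) (fun k => lev (k + 1)) (fun k => rs (k + 1)) n)
        + Qstep Lc M (lev 1) (rs 1) * compIns₁ Lc (fine Lc M) (fun k => lev (k + 1)) (fun k => rs (k + 1)) n (h + h')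
      = (((Lc : ℝ) ^ (d + 1) * stepScale d Lc (lev 1)) * (∏ i ∈ range n, (stepScale d Lc (lev (i + 1 + 1)) * ((box (d + 1) Lc).card : ℝ)))⁻¹) •
            (stepIns₁ M Lc (rs 1) (compRows Lc (fine Lc M) (fun k => lev (k + 1)) (fun k => rs (k + 1)) n *ᵥ h)
              * compRows Lc (fine Lc M) (fun k => lev (k + 1)) (fun k => rs (k + 1)) n)
          + Qstep Lc M (lev 1) (rs 1) * compIns₁ Lc (fine Lc M) (fun k => lev (k + 1)) (fun k => rs (k + 1)) n h
        + ((((Lc : ℝ) ^ (d + 1) * stepScale d Lc (lev 1)) * (∏ i ∈ range n, (stepScale d Lc (lev (i + 1 + 1)) * ((box (d + 1) Lc).card : ℝ)))⁻¹) •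
            (stepIns₁ M Lc (rs 1) (compRows Lc (fine Lc M) (fun k => lev (k + 1)) (fun k => rs (k + 1)) n *ᵥ h')
              * compRows Lc (fine Lc M) (fun k => lev (k + 1)) (fun k => rs (k + 1)) n)
          + Qstep Lc M (lev 1) (rs 1) * compIns₁ Lc (fine Lc M) (fun k => lev (k + 1)) (fun k => rs (k + 1)) n h') := by
  rw [ih, Matrix.mulVec_add, stepIns₁_add, Matrix.add_mul, smul_add, Matrix.mul_add]
  abel

/-- [folklore] `compIns₁` is additive in the direction (induction; both chain-rule summands are linear). -/
theorem compIns₁_add :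
    ∀ (n : ℕ) (M : Fin (d + 1) → ℕ) [∀ μ, NeZero (M μ)] (lev : ℕ → ℕ) (rs : ℕ → (Fin (d + 1) → ℕ))
      (h h' : ↥(pbox (towerTorus Lc M n)) × Fin (d + 1) → ℝ),
      compIns₁ Lc M lev rs n (h + h') = compIns₁ Lc M lev rs n h + compIns₁ Lc M lev rs n h'
  | 0, M, _, lev, rs, h, h' => by simp only [compIns₁_zero, add_zero]
  | n + 1, M, _, lev, rs, h, h' => compIns₁_add_step Lc n M lev rs h h' (compIns₁_add n (fine Lc M) (fun k => lev (k + 1)) (fun k => rs (k + 1)) h h')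

/-- [folklore] homogeneity, THE INDUCTION STEP (push-inside types). -/
theorem compIns₁_smul_step (n : ℕ) (M : Fin (d + 1) → ℕ) [∀ μ, NeZero (M μ)] (lev : ℕ → ℕ) (rs : ℕ → (Fin (d + 1) → ℕ)) (a : ℝ)
    (h : ↥(pbox (towerTorus Lc (fine Lc M) n)) × Fin (d + 1) → ℝ)
    (ih : compIns₁ Lc (fine Lc M) (fun k => lev (k + 1)) (fun k => rs (k + 1)) n (a • h)
      = a • compIns₁ Lc (fine Lc M) (fun k => lev (k + 1)) (fun k => rs (k + 1)) n h) :
    (((Lc : ℝ) ^ (d + 1) * stepScale d Lc (lev 1)) * (∏ i ∈ range n, (stepScale d Lc (lev (i + 1 + 1)) * ((box (d + 1) Lc).card : ℝ)))⁻¹) •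
          (stepIns₁ M Lc (rs 1) (compRows Lc (fine Lc M) (fun k => lev (k + 1)) (fun k => rs (k + 1)) n *ᵥ (a • h))
            * compRows Lc (fine Lc M) (fun k => lev (k + 1)) (fun k => rs (k + 1)) n)
        + Qstep Lc M (lev 1) (rs 1) * compIns₁ Lc (fine Lc M) (fun k => lev (k + 1)) (fun k => rs (k + 1)) n (a • h)
      = a • ((((Lc : ℝ) ^ (d + 1) * stepScale d Lc (lev 1)) * (∏ i ∈ range n, (stepScale d Lc (lev (i + 1 + 1)) * ((box (d + 1) Lc).card : ℝ)))⁻¹) •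
            (stepIns₁ M Lc (rs 1) (compRows Lc (fine Lc M) (fun k => lev (k + 1)) (fun k => rs (k + 1)) n *ᵥ h)
              * compRows Lc (fine Lc M) (fun k => lev (k + 1)) (fun k => rs (k + 1)) n)
          + Qstep Lc M (lev 1) (rs 1) * compIns₁ Lc (fine Lc M) (fun k => lev (k + 1)) (fun k => rs (k + 1)) n h) := by
  rw [ih, Matrix.mulVec_smul, stepIns₁_smul, Matrix.smul_mul, Matrix.mul_smul, smul_add, smul_comm a]

/-- [folklore] `compIns₁` is homogeneous in the direction. -/
theorem compIns₁_smul :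
    ∀ (n : ℕ) (M : Fin (d + 1) → ℕ) [∀ μ, NeZero (M μ)] (lev : ℕ → ℕ) (rs : ℕ → (Fin (d + 1) → ℕ)) (a : ℝ)
      (h : ↥(pbox (towerTorus Lc M n)) × Fin (d + 1) → ℝ),
      compIns₁ Lc M lev rs n (a • h) = a • compIns₁ Lc M lev rs n h
  | 0, M, _, lev, rs, a, h => by simp only [compIns₁_zero, smul_zero]
  | n + 1, M, _, lev, rs, a, h => compIns₁_smul_step Lc n M lev rs a h (compIns₁_smul n (fine Lc M) (fun k => lev (k + 1)) (fun k => rs (k + 1)) a h)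

/-- [folklore] **THE COMPOSITE AVERAGING OF A PURE GAUGE IS A PURE GAUGE OF `λ ∘ itRoot` ON THE TOP TORUS**, times `σ_n` (PART 1's `compRows_mul_tgrad` on the
vector `λ`): `compRows … n · (Dλ) = σ_n · D_M (λ ∘ itRoot n)`. -/
theorem compRows_mulVec_tgrad_fun (n : ℕ) (M : Fin (d + 1) → ℕ) [∀ μ, NeZero (M μ)] (lev : ℕ → ℕ) (rs : ℕ → (Fin (d + 1) → ℕ))
    (hrs : ∀ k, rs k ∈ box (d + 1) Lc) (lam : ↥(pbox (towerTorus Lc M n)) → ℝ) :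
    compRows Lc M lev rs n *ᵥ (fun b : ↥(pbox (towerTorus Lc M n)) × Fin (d + 1) =>
        ∑ s : ↥(pbox (towerTorus Lc M n)), tgrad (towerTorus Lc M n) (b.1, Sum.inl b.2) s * lam s)
      = (∏ i ∈ range n, (stepScale d Lc (lev (i + 1)) * ((box (d + 1) Lc).card : ℝ))) •
          (fun a : ↥(pbox M) × Fin (d + 1) => ∑ t : ↥(pbox M), tgrad M (a.1, Sum.inl a.2) t * lam (itRoot Lc M rs hrs n t)) := by
  have e : (fun b : ↥(pbox (towerTorus Lc M n)) × Fin (d + 1) => ∑ s : ↥(pbox (towerTorus Lc M n)), tgrad (towerTorus Lc M n) (b.1, Sum.inl b.2) s * lam s)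
      = (tgrad (towerTorus Lc M n)).submatrix
          (fun b : ↥(pbox (towerTorus Lc M n)) × Fin (d + 1) => ((b.1, Sum.inl b.2) : Idx (towerTorus Lc M n) (Fib d))) id *ᵥ lam := rfl
  rw [e, Matrix.mulVec_mulVec, compRows_mul_tgrad Lc n M lev rs hrs, Matrix.smul_mulVec, ← Matrix.mulVec_mulVec]
  congr 1
  funext a
  simp only [Matrix.mulVec, dotProduct, Matrix.submatrix_apply, id, Matrix.of_apply, sum_tdelta_mul, wrapPt_of_mem]

/-- [folklore] **(T-β-m) ORDER 1, THE INDUCTION STEP** (push-inside types): the top step's jet along the transported pure gauge `σ_n·D(λ ∘ itRoot n)` is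
`c_ℓ·σ_n·θ_n = 1` times `R′·Qstep − Qstep·R` (`stepIns₁_pureGauge_fun` at `λ ∘ itRoot n`), and `Qstep·(R·C − C·E)` from below: the `R`-terms cancel. -/
theorem compIns₁_pureGauge_step (n : ℕ) (M : Fin (d + 1) → ℕ) [∀ μ, NeZero (M μ)] (lev : ℕ → ℕ) (rs : ℕ → (Fin (d + 1) → ℕ))
    (hrs : ∀ k, rs k ∈ box (d + 1) Lc) (lam : ↥(pbox (towerTorus Lc (fine Lc M) n)) → ℝ)
    (ih : compIns₁ Lc (fine Lc M) (fun k => lev (k + 1)) (fun k => rs (k + 1)) n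
        (fun b : ↥(pbox (towerTorus Lc (fine Lc M) n)) × Fin (d + 1) =>
          ∑ s : ↥(pbox (towerTorus Lc (fine Lc M) n)), tgrad (towerTorus Lc (fine Lc M) n) (b.1, Sum.inl b.2) s * lam s)
      = Matrix.diagonal (fun a : ↥(pbox (fine Lc M)) × Fin (d + 1) => lam (itRoot Lc (fine Lc M) (fun k => rs (k + 1)) (fun k => hrs (k + 1)) n a.1))
          * compRows Lc (fine Lc M) (fun k => lev (k + 1)) (fun k => rs (k + 1)) n
        - compRows Lc (fine Lc M) (fun k => lev (k + 1)) (fun k => rs (k + 1)) n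
          * Matrix.diagonal (fun b : ↥(pbox (towerTorus Lc (fine Lc M) n)) × Fin (d + 1) => lam b.1)) :
    (((Lc : ℝ) ^ (d + 1) * stepScale d Lc (lev 1)) * (∏ i ∈ range n, (stepScale d Lc (lev (i + 1 + 1)) * ((box (d + 1) Lc).card : ℝ)))⁻¹) •
          (stepIns₁ M Lc (rs 1) ((compRows Lc (fine Lc M) (fun k => lev (k + 1)) (fun k => rs (k + 1)) n) *ᵥ
              (fun b : ↥(pbox (towerTorus Lc (fine Lc M) n)) × Fin (d + 1) =>
                ∑ s : ↥(pbox (towerTorus Lc (fine Lc M) n)), tgrad (towerTorus Lc (fine Lc M) n) (b.1, Sum.inl b.2) s * lam s))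
            * compRows Lc (fine Lc M) (fun k => lev (k + 1)) (fun k => rs (k + 1)) n)
        + Qstep Lc M (lev 1) (rs 1) * compIns₁ Lc (fine Lc M) (fun k => lev (k + 1)) (fun k => rs (k + 1)) n
            (fun b : ↥(pbox (towerTorus Lc (fine Lc M) n)) × Fin (d + 1) =>
              ∑ s : ↥(pbox (towerTorus Lc (fine Lc M) n)), tgrad (towerTorus Lc (fine Lc M) n) (b.1, Sum.inl b.2) s * lam s)
      = Matrix.diagonal (fun a : ↥(pbox M) × Fin (d + 1) =>
            lam (itRoot Lc (fine Lc M) (fun k => rs (k + 1)) (fun k => hrs (k + 1)) n (rootPt M Lc (hrs 1) a.1)))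
          * (Qstep Lc M (lev 1) (rs 1) * compRows Lc (fine Lc M) (fun k => lev (k + 1)) (fun k => rs (k + 1)) n)
        - Qstep Lc M (lev 1) (rs 1) * compRows Lc (fine Lc M) (fun k => lev (k + 1)) (fun k => rs (k + 1)) n
          * Matrix.diagonal (fun b : ↥(pbox (towerTorus Lc (fine Lc M) n)) × Fin (d + 1) => lam b.1) := by
  have hB : (box (d + 1) Lc).Nonempty := ⟨rs 0, hrs 0⟩
  have hθ : ((Lc : ℝ) ^ (d + 1) * stepScale d Lc (lev 1)) * (∏ i ∈ range n, (stepScale d Lc (lev (i + 1 + 1)) * ((box (d + 1) Lc).card : ℝ)))⁻¹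
      * ((∏ i ∈ range n, (stepScale d Lc (lev (i + 1 + 1)) * ((box (d + 1) Lc).card : ℝ))) * ((Lc : ℝ) ^ (d + 1) * stepScale d Lc (lev 1))⁻¹) = 1 := by
    rw [← mul_assoc, inv_mul_cancel_right₀ (prod_stepScale_mul_card_ne_zero' Lc hB (fun i => lev (i + 1 + 1)) n),
      mul_inv_cancel₀ (mul_ne_zero (pow_ne_zero _ (by exact_mod_cast NeZero.ne Lc)) (stepScale_ne_zero _))]
  rw [compRows_mulVec_tgrad_fun Lc n (fine Lc M) _ _ (fun k => hrs (k + 1)) lam, stepIns₁_smul,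
    stepIns₁_pureGauge_fun M Lc (hrs 1) (lev 1) (fun t => lam (itRoot Lc (fine Lc M) (fun k => rs (k + 1)) (fun k => hrs (k + 1)) n t)), ih,
    smul_smul, Matrix.smul_mul, smul_smul, hθ, one_smul]
  simp only [Matrix.sub_mul, Matrix.mul_sub, Matrix.mul_assoc]
  abel

/-- [folklore] **`compIns₁_pureGauge_fun` — (T-β-m) ORDER 1: THE COMPOSITE FIRST-ORDER INSERTION JET ALONG A TORUS PURE GAUGE IS THE COMMUTATOR OF THE COMPOSITE
AVERAGING WITH THE DIAGONAL GAUGE GENERATORS**, at every depth: `compIns₁ … n (Dλ) = diagonal (λ (itRoot n a.1)) · compRows … n − compRows … n · diagonal (λ b.1)`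
(fields: `λ` at the base of their bond on the finest torus; multipliers: `λ` at the ITERATED ROOT of their coarse site).  No constants survive. -/
theorem compIns₁_pureGauge_fun :
    ∀ (n : ℕ) (M : Fin (d + 1) → ℕ) [∀ μ, NeZero (M μ)] (lev : ℕ → ℕ) (rs : ℕ → (Fin (d + 1) → ℕ)) (hrs : ∀ k, rs k ∈ box (d + 1) Lc)
      (lam : ↥(pbox (towerTorus Lc M n)) → ℝ),
      compIns₁ Lc M lev rs n (fun b : ↥(pbox (towerTorus Lc M n)) × Fin (d + 1) =>
          ∑ s : ↥(pbox (towerTorus Lc M n)), tgrad (towerTorus Lc M n) (b.1, Sum.inl b.2) s * lam s)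
        = Matrix.diagonal (fun a : ↥(pbox M) × Fin (d + 1) => lam (itRoot Lc M rs hrs n a.1)) * compRows Lc M lev rs n
          - compRows Lc M lev rs n * Matrix.diagonal (fun b : ↥(pbox (towerTorus Lc M n)) × Fin (d + 1) => lam b.1)
  | 0, M, _, lev, rs, hrs, lam => by
    show (0 : Matrix (↥(pbox M) × Fin (d + 1)) (↥(pbox M) × Fin (d + 1)) ℝ)
      = Matrix.diagonal (fun a : ↥(pbox M) × Fin (d + 1) => lam a.1) * (1 : Matrix (↥(pbox M) × Fin (d + 1)) (↥(pbox M) × Fin (d + 1)) ℝ)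
        - (1 : Matrix (↥(pbox M) × Fin (d + 1)) (↥(pbox M) × Fin (d + 1)) ℝ) * Matrix.diagonal (fun b : ↥(pbox M) × Fin (d + 1) => lam b.1)
    rw [Matrix.mul_one, Matrix.one_mul, sub_self]
  | n + 1, M, _, lev, rs, hrs, lam =>
    compIns₁_pureGauge_step Lc n M lev rs hrs lam (compIns₁_pureGauge_fun n (fine Lc M) (fun k => lev (k + 1)) (fun k => rs (k + 1)) (fun k => hrs (k + 1)) lam)

end Tower

/-! ## §3 The door's `q1` letter for the composite averaging -/

section Letter

variable (Lc : ℕ) [NeZero Lc] (M' : Fin (d + 1) → ℕ) [∀ μ, NeZero (M' μ)] (lev : ℕ → ℕ) (rs : ℕ → (Fin (d + 1) → ℕ))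

/-- [folklore] **`torus_q1_tower` — #19 ∕ #21's `q1 : Xbar * 𝔔₀ + 𝔔₁ + 𝔔₀ * X = 𝔔′₁` FOR THE COMPOSITE AVERAGING AT EVERY DEPTH** (the shape of my g21
`torus_q1_letter`): `X := −(c • E_λ)` (#21's `hX`), `Xbar := c • diagonal (Σ_t tdelta M′ (pμ′ α + toSite (rs 0)) t · λ (itRoot (n+1) t))`, `𝔔₀ := Q₂₀ · compRows`,
`𝔔₁ := Q₂₁(h) · compRows + Q₂₀ · (c • compIns₁ h)` with PART 2's `Q₂₁(w) := Σ_{a′} (c·θ_{n+1}·(compRows · w) a′) • T^{a′}`, `𝔔′₁ :=` the same word along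
`h + Dλ`.  Proof: linearity (§1–§2), `compIns₁_pureGauge_fun` at the finest level, `compRows_mulVec_tgrad_fun` + my g18 `torus_pureGauge_fun_of_presentation`
one level up (`c·θ_{n+1}·σ_{n+1}·c_{lev 0} = c`); the two `R`-terms cancel. -/
theorem torus_q1_tower (hrs : ∀ k, rs k ∈ box (d + 1) Lc) (hM' : ∀ i, Lc ∣ M' i) (n : ℕ) (c : ℝ)
    (h : ↥(pbox (towerTorus Lc M' (n + 1))) × Fin (d + 1) → ℝ) (lam : ↥(pbox (towerTorus Lc M' (n + 1))) → ℝ)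
    {κ : Type*} [Fintype κ] [DecidableEq κ] (pμ' : κ → ↥(pbox M')) (mμ' : κ → Fin (d + 1))
    {Q₂₀ : Matrix κ (↥(pbox M') × Fin (d + 1)) ℝ}
    (hQ₂₀ : Q₂₀ = (perF M' (bhKStepAt d (toSite (rs 0)) Lc (lev 0))).submatrix (fun a : κ => ((pμ' a, Sum.inr (mμ' a)) : Idx M' (Fib d)))
        (fun b : ↥(pbox M') × Fin (d + 1) => ((b.1, Sum.inl b.2) : Idx M' (Fib d))))
    (Q₂₁ : (↥(pbox (towerTorus Lc M' (n + 1))) × Fin (d + 1) → ℝ) → Matrix κ (↥(pbox M') × Fin (d + 1)) ℝ)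
    (hQ₂₁ : ∀ w, Q₂₁ w = ∑ a' : ↥(pbox M') × Fin (d + 1),
        ((c * (((Lc : ℝ) ^ (d + 1) * stepScale d Lc (lev 0)) * (∏ i ∈ range (n + 1), (stepScale d Lc (lev (i + 1)) * ((box (d + 1) Lc).card : ℝ)))⁻¹))
          * (compRows Lc M' lev rs (n + 1) *ᵥ w) a') •
        (perF M' (dper M' (vhSAt (toSite (rs 0)) d Lc rfl a'.2 (a'.1 : Site (d + 1))))).submatrix (fun k : κ => ((pμ' k, Sum.inr (mμ' k)) : Idx M' (Fib d)))
          (fun b : ↥(pbox M') × Fin (d + 1) => ((b.1, Sum.inl b.2) : Idx M' (Fib d))))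
    {𝔔₀ 𝔔₁ : Matrix κ (↥(pbox (towerTorus Lc M' (n + 1))) × Fin (d + 1)) ℝ} (h𝔔₀ : Q₂₀ * compRows Lc M' lev rs (n + 1) = 𝔔₀)
    (h𝔔₁ : Q₂₁ h * compRows Lc M' lev rs (n + 1) + Q₂₀ * (c • compIns₁ Lc M' lev rs (n + 1) h) = 𝔔₁) :
    (c • Matrix.diagonal (fun α : κ => ∑ t : ↥(pbox M'), tdelta M' ((pμ' α : Site (d + 1)) + toSite (rs 0)) t * lam (itRoot Lc M' rs hrs (n + 1) t))) * 𝔔₀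
        + 𝔔₁
        + 𝔔₀ * (-(c • Matrix.diagonal (fun b : ↥(pbox (towerTorus Lc M' (n + 1))) × Fin (d + 1) => lam b.1)))
      = Q₂₁ (fun b => h b + ∑ s : ↥(pbox (towerTorus Lc M' (n + 1))), tgrad (towerTorus Lc M' (n + 1)) (b.1, Sum.inl b.2) s * lam s)
          * compRows Lc M' lev rs (n + 1)
        + Q₂₀ * (c • compIns₁ Lc M' lev rs (n + 1)
            (fun b => h b + ∑ s : ↥(pbox (towerTorus Lc M' (n + 1))), tgrad (towerTorus Lc M' (n + 1)) (b.1, Sum.inl b.2) s * lam s)) := by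
  subst h𝔔₀ h𝔔₁
  have hB : (box (d + 1) Lc).Nonempty := ⟨rs 0, hrs 0⟩
  have hσ := prod_stepScale_mul_card_ne_zero' Lc hB (fun i => lev (i + 1)) (n + 1)
  have hL : (Lc : ℝ) ^ (d + 1) * stepScale d Lc (lev 0) ≠ 0 := mul_ne_zero (pow_ne_zero _ (by exact_mod_cast NeZero.ne Lc)) (stepScale_ne_zero _)
  have hθ : c * (((Lc : ℝ) ^ (d + 1) * stepScale d Lc (lev 0)) * (∏ i ∈ range (n + 1), (stepScale d Lc (lev (i + 1)) * ((box (d + 1) Lc).card : ℝ)))⁻¹)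
      * (∏ i ∈ range (n + 1), (stepScale d Lc (lev (i + 1)) * ((box (d + 1) Lc).card : ℝ))) * ((Lc : ℝ) ^ (d + 1) * stepScale d Lc (lev 0))⁻¹ = c := by
    rw [show c * (((Lc : ℝ) ^ (d + 1) * stepScale d Lc (lev 0)) * (∏ i ∈ range (n + 1), (stepScale d Lc (lev (i + 1)) * ((box (d + 1) Lc).card : ℝ)))⁻¹)
        * (∏ i ∈ range (n + 1), (stepScale d Lc (lev (i + 1)) * ((box (d + 1) Lc).card : ℝ))) * ((Lc : ℝ) ^ (d + 1) * stepScale d Lc (lev 0))⁻¹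
        = c * (((Lc : ℝ) ^ (d + 1) * stepScale d Lc (lev 0)) * ((Lc : ℝ) ^ (d + 1) * stepScale d Lc (lev 0))⁻¹)
          * ((∏ i ∈ range (n + 1), (stepScale d Lc (lev (i + 1)) * ((box (d + 1) Lc).card : ℝ)))
            * (∏ i ∈ range (n + 1), (stepScale d Lc (lev (i + 1)) * ((box (d + 1) Lc).card : ℝ)))⁻¹) by ring,
      mul_inv_cancel₀ hσ, mul_inv_cancel₀ hL, mul_one, mul_one]
  -- the coarse jet along `h + Dλ`: linearity, then the transported pure gauge is `σ·D(λ ∘ itRoot)` one level up and my g18 law in the door's presentation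
  have h2 : Q₂₁ (fun b => h b + ∑ s : ↥(pbox (towerTorus Lc M' (n + 1))), tgrad (towerTorus Lc M' (n + 1)) (b.1, Sum.inl b.2) s * lam s)
      = Q₂₁ h + c • (Matrix.diagonal (fun α : κ => ∑ t : ↥(pbox M'), tdelta M' ((pμ' α : Site (d + 1)) + toSite (rs 0)) t * lam (itRoot Lc M' rs hrs (n + 1) t)) * Q₂₀
          - Q₂₀ * Matrix.diagonal (fun a : ↥(pbox M') × Fin (d + 1) => lam (itRoot Lc M' rs hrs (n + 1) a.1))) := by
    rw [hQ₂₁, hQ₂₁]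
    show (∑ a' : ↥(pbox M') × Fin (d + 1),
        ((c * (((Lc : ℝ) ^ (d + 1) * stepScale d Lc (lev 0)) * (∏ i ∈ range (n + 1), (stepScale d Lc (lev (i + 1)) * ((box (d + 1) Lc).card : ℝ)))⁻¹))
          * (compRows Lc M' lev rs (n + 1) *ᵥ (h + fun b : ↥(pbox (towerTorus Lc M' (n + 1))) × Fin (d + 1) =>
              ∑ s : ↥(pbox (towerTorus Lc M' (n + 1))), tgrad (towerTorus Lc M' (n + 1)) (b.1, Sum.inl b.2) s * lam s)) a') •
        (perF M' (dper M' (vhSAt (toSite (rs 0)) d Lc rfl a'.2 (a'.1 : Site (d + 1))))).submatrix (fun k : κ => ((pμ' k, Sum.inr (mμ' k)) : Idx M' (Fib d)))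
          (fun b : ↥(pbox M') × Fin (d + 1) => ((b.1, Sum.inl b.2) : Idx M' (Fib d)))) = _
    rw [Matrix.mulVec_add, compRows_mulVec_tgrad_fun Lc (n + 1) M' lev rs hrs lam]
    rw [Finset.sum_congr rfl fun a' _ => by
      rw [show (c * (((Lc : ℝ) ^ (d + 1) * stepScale d Lc (lev 0)) * (∏ i ∈ range (n + 1), (stepScale d Lc (lev (i + 1)) * ((box (d + 1) Lc).card : ℝ)))⁻¹))
          * (compRows Lc M' lev rs (n + 1) *ᵥ h
              + (∏ i ∈ range (n + 1), (stepScale d Lc (lev (i + 1)) * ((box (d + 1) Lc).card : ℝ))) •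
                (fun a : ↥(pbox M') × Fin (d + 1) => ∑ t : ↥(pbox M'), tgrad M' (a.1, Sum.inl a.2) t * lam (itRoot Lc M' rs hrs (n + 1) t))) a'
        = (c * (((Lc : ℝ) ^ (d + 1) * stepScale d Lc (lev 0)) * (∏ i ∈ range (n + 1), (stepScale d Lc (lev (i + 1)) * ((box (d + 1) Lc).card : ℝ)))⁻¹))
            * (compRows Lc M' lev rs (n + 1) *ᵥ h) a'
          + (c * (((Lc : ℝ) ^ (d + 1) * stepScale d Lc (lev 0)) * (∏ i ∈ range (n + 1), (stepScale d Lc (lev (i + 1)) * ((box (d + 1) Lc).card : ℝ)))⁻¹))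
            * (∏ i ∈ range (n + 1), (stepScale d Lc (lev (i + 1)) * ((box (d + 1) Lc).card : ℝ)))
            * ∑ t : ↥(pbox M'), tgrad M' (a'.1, Sum.inl a'.2) t * lam (itRoot Lc M' rs hrs (n + 1) t) from by
          simp only [Pi.add_apply, Pi.smul_apply, smul_eq_mul]; ring,
        add_smul, mul_smul (c * (((Lc : ℝ) ^ (d + 1) * stepScale d Lc (lev 0))
            * (∏ i ∈ range (n + 1), (stepScale d Lc (lev (i + 1)) * ((box (d + 1) Lc).card : ℝ)))⁻¹)
          * (∏ i ∈ range (n + 1), (stepScale d Lc (lev (i + 1)) * ((box (d + 1) Lc).card : ℝ))))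
          (∑ t : ↥(pbox M'), tgrad M' (a'.1, Sum.inl a'.2) t * lam (itRoot Lc M' rs hrs (n + 1) t))],
      Finset.sum_add_distrib, ← Finset.smul_sum]
    have hlaw := torus_pureGauge_fun_of_presentation (M := M') (M'' := fun i => M' i / Lc) (fun i => (Nat.mul_div_cancel' (hM' i)).symm) (hrs 0) (lev 0)
        (fun t => lam (itRoot Lc M' rs hrs (n + 1) t)) (fun k : κ => (pμ' k : Site (d + 1))) (fun k => (pμ' k).2) mμ' hQ₂₀
    simp only [Subtype.coe_eta] at hlaw
    rw [hlaw, smul_smul, hθ]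
  -- the fine jet along `h + Dλ`: linearity and `compIns₁_pureGauge_fun`
  have h1 : c • compIns₁ Lc M' lev rs (n + 1)
        (fun b => h b + ∑ s : ↥(pbox (towerTorus Lc M' (n + 1))), tgrad (towerTorus Lc M' (n + 1)) (b.1, Sum.inl b.2) s * lam s)
      = c • compIns₁ Lc M' lev rs (n + 1) h + c • (Matrix.diagonal (fun a : ↥(pbox M') × Fin (d + 1) => lam (itRoot Lc M' rs hrs (n + 1) a.1))
          * compRows Lc M' lev rs (n + 1)
        - compRows Lc M' lev rs (n + 1) * Matrix.diagonal (fun b : ↥(pbox (towerTorus Lc M' (n + 1))) × Fin (d + 1) => lam b.1)) := by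
    show c • compIns₁ Lc M' lev rs (n + 1) (h + fun b : ↥(pbox (towerTorus Lc M' (n + 1))) × Fin (d + 1) =>
        ∑ s : ↥(pbox (towerTorus Lc M' (n + 1))), tgrad (towerTorus Lc M' (n + 1)) (b.1, Sum.inl b.2) s * lam s) = _
    rw [compIns₁_add, compIns₁_pureGauge_fun Lc (n + 1) M' lev rs hrs lam, smul_add]
  rw [h2, h1]
  simp only [Matrix.add_mul, Matrix.mul_add, Matrix.sub_mul, Matrix.mul_sub, Matrix.smul_mul, Matrix.mul_smul, Matrix.mul_neg, smul_sub, Matrix.mul_assoc]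
  abel

end Letter

end Summit.QuantumFields.BalabanUV.Beta.FP.TorusCompositeIndexWardOne

end
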